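import Summits.AtomisticToContinuum.BoseEinsteinCondensation.Theses.BECStronglyRayleigh
import Summits.AtomisticToContinuum.BoseEinsteinCondensation.Theorems.InsertionFieldDelocalisation.Negative.Tightness
import Summits.AtomisticToContinuum.BoseEinsteinCondensation.Theorems.InsertionFieldDelocalisation.Negative.LoadBearing
import HarnessLib

/-!
# Route `BECStronglyRayleigh`, crux `InsertionFieldDelocalisation` (stmt-AtomisticToContinuum-9673),
# line `cosh-budget-penrose-onsager` — CHECKED SKELETON (crux-plan, round 1)

Crux (by name, concluded by `InsertionFieldDelocalisation_of` below): one constant `M` such that for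
every `L ≥ 2`, every `2 ≤ N ≤ L³/2` and every entrywise-nonnegative sector-`N` ground vector `ψ` of the
hard-core boson / ferro-XY Hamiltonian `xyTorus 3 L 1`,
`L³ · Σ_T ‖r^T‖²Φ_T ≤ M · Σ_T ‖r^T‖²` for the two-particle insertion field
`r^T_x = Σ_y Re ψ(1_{T ∪ {x,y}})` (`|T| = N - 2`, `‖r‖²Φ(r) = Σr³/Σr + (Σr²)²/(Σr)²`); in the
vocabulary of the landed `Negative/Toolkit.lean`: `∃ M, InsertionFieldDelocalisationAt M`, with body
`K1Ineq M L N ψ` (`Negative.insertionFieldDelocalisation_iff`, `Iff.rfl`).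

## The line (card `Ideas/cosh-budget-penrose-onsager.md`; triage r1-1/2/3: pass ×3)

INDUCTION ON THE PARTICLE NUMBER through the Penrose–Onsager (PO) trial vector
`Φ_{N+1} := A†ψ_N`, `Φ(S) = Σ_{u ∈ S} ψ_N(S ∖ u)` (`poVec`): insert one flat boson into the `N`-particle
ground state. Two facts make the induction run:

* (flatness is INHERITED by `Φ`) the insertion fields of `Φ_{N+1}` are positive mixtures of a FLAT
  field and of insertion fields of `ψ_N` itself:
  `r^T_x[Φ] = R'_T + (L³-2N) u'_T(x) + Σ_{z∈T} r'^{T∖z}_x` and `u^T_x[Φ] = ψ_N(T) + Σ_{z∈T} u'^{T∖z}(x)`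
  (`u` = ONE-particle insertion field `u^T_x = Re ψ(1_{T∪x})`, `|T| = N`; primes = level `N`). The
  one-particle field enters the two-particle field of `Φ` with mass fraction `≍ 1/N` per level — not
  summable — so the induction is run JOINTLY on the two-particle functional `K1Ineq` (the crux) and
  its one-particle twin `K1IneqOne` (this plan's sharpening; the pair is closed under `A†`):
  `stub_poAveraging`, loss factor `lossA = 1 + C_A·slack`, `slack = 1/(N+1)² + 1/√((N+1)L³)`, on `max(M, M₁)`.
* (flatness is TRANSPORTED from `Φ_{N+1}` to `ψ_{N+1}`) at a cost controlled by the WITHIN-BACKGROUND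
  cosh-discrepancy `disc` of `h = log ψ_{N+1} - log Φ_{N+1}` (one background particle set `T`,
  `|T| = N`, the inserted particle relocated `x → x'`, weights `Φ(T∪x)Φ(T∪x')`; exponential = cosh
  moments) plus `slack`: `stub_discrepancyTransport`, loss factor `lossT = 1 + C_T(η + slack)` — the HARDEST stub (it carries the answer to triage
  objections r1-1/r1-2: the `ω`-law of the background is tilted by `e^{2h̄_T}`, and only the
  within-background = relocation discrepancy is summable over `N`; the global variance of `h`,
  `≍ 1/L` per level, is not, in any order).
* (the discrepancy is PAID FOR by an exact energy identity) the COSH-BUDGET IDENTITY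
  `Σ_{directed token edges} Φ(S)Φ(S')(cosh ∇h - 1) = 2(⟨Φ,HΦ⟩ - E(N+1)‖Φ‖²)` (`stub_coshBudgetIdentity`,
  exact, provable now — the card's lever), the PO BUDGET `⟨Φ,HΦ⟩ - E(N+1)‖Φ‖² ≤ (C_B/L³)‖Φ‖²`
  (`stub_poExcessBudget` = the card's (B2⁺) at the exponent the toy j009506 shows,
  `(E_Φ - E)·L³ ≈ 1.0–1.6`; triage r1-3's exponent correction applied), and a RELOCATION POINCARÉ
  inequality at the affordable scale `L` converting the nearest-neighbour cosh form into the
  relocation cosh form, `disc·‖Φ‖²·(N+1) ≤ C_P L^{5/2} · edgeDisc · wdisc` (`stub_relocationPoincare`;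
  the kinetic normalisation `Σ_edges ΦΦ' ≍ 3(N+1)‖Φ‖²` is folded in). Together:
  `disc ≤ η_{L,N+1} · wdisc` with `η_{L,k} = 2C_PC_B L²√L/(k L³)` and
  `Σ_{k ≤ L³/2} η_{L,k} ≤ 12 C_P C_B` (harmonic sum `≤ log L³ ≤ 6√L`).
* Base `N = 2` (`stub_twoBodyBase`): the two-body torus ground state is a function of `x - y`, so
  `r^∅` is exactly flat (constant `2`) and the one-particle profile is the pair function (`≤ 4`).

Composition (kernel-checked, no `sorry` of its own): `levels` (the induction:
`bnd L n = 4 · Π_{k=3}^{n} lossA·lossT` bounds both functionals at level `n`), `bnd_le` (the product is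
`≤ 4·exp((5/2)C_A + C_T(12 C_P C_B + 5/2))` uniformly in `L ≥ 3`, `2n ≤ L³`), the side `L = 2` by the landed
ceiling `Negative.K1Ineq_two_mul_cube` (`M ≥ 16`), and `InsertionFieldDelocalisation_of :
BECStronglyRayleigh.InsertionFieldDelocalisation` — the crux BY NAME from the six registered `stub_*`.

Disproof.lean (cdisprove v3, = landed `Negative/{Toolkit,PerronExistence,LoadBearing,Tightness}`)
honoured: `insertionFieldDelocalisation_false_without_groundState` — every stub quantifies over
`IsGround` data (sector + eigen-equation + nonnegativity), and `stub_coshBudgetIdentity` IS the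
eigen-equation (constant local energy, symmetrised); `…_false_without_halfFilling` — every stub carries
`2(N+1) ≤ L³` (used in `stub_poExcessBudget`: `|E_Φ| ≥ 3(N+1)(1-ν)`, and in the flat parts of
`stub_poAveraging`); `four_le_const` / `not_insertionFieldDelocalisationAt_of_lt_four` — the delivered
constant is `max(4·exp(…), 16) ≥ 16`, the base constants `2, 4` concern `N = 2` only (floor `2L³/L³`);
`K1_ceiling`/`K1Ineq_two_mul_cube` — imported and USED (side `L = 2`). No stub is an instance of a
landed Negative lemma's negation (checked: the only refuted shapes are "no eigen-equation",
"N > L³/2", "M < 4 uniformly").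

Conventions: statements of the registered stubs are the `Prop`s `Sig.stub_<name>`; the registered
obligations are `theorem stub_<name> : Sig.stub_<name> := by sorry` (the ONLY sorries of this file).
All levels are written as `(N, N+1)` (no natural subtraction in hypotheses): `ψ'` is a level-`N`
ground vector, `poVec ψ'` and `ψ` live at level `N + 1`.

References: PenroseOnsager1956 (doi:10.1103/PhysRev.104.576) (the insertion heuristic
`a₀†Ψ_{N-1} ≈ √n₀ Ψ_N`); LSSY2005 Ch. 11 (lattice BEC at fillings `≠ ½` open); KipnisVaradhan1986
(doi:10.1007/BF01210789), Komorowski–Landim–Olla 2012 Ch. 2 (`H₋₁` of reversible lattice gases);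
Jerrum–Sinclair 1989 (doi:10.1016/0890-5401(89)90067-9) (canonical paths); Diaconis–Shahshahani 1987
(Bernoulli–Laplace relocation chain); the toy ED jobs j009506 (ideator) and j011617 (this plan:
PO-averaging loss, transport loss vs relocation discrepancy, tilt/profile split).
-/

noncomputable section

namespace Summit.AtomisticToContinuum.BoseEinsteinCondensation.Cruxes.InsertionFieldDelocalisation.CoshBudgetPenroseOnsager

open scoped BigOperators ComplexOrder
open Literature.MathematicalPhysics.QuantumLattice Literature.Probability.LatticeModels Matrix Finset
open Summit.AtomisticToContinuum.BoseEinsteinCondensation.Theses.BECStronglyRayleigh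
open Summit.AtomisticToContinuum.BoseEinsteinCondensation.Theorems.InsertionFieldDelocalisation.Negative

/-! ## Vocabulary of the line (to be landed verbatim as the `<Route><Crux>Defs` file) -/

section Vocabulary

variable {L : ℕ}

/-- The occupation configuration `1_S` of a set of sites (occupied = `Fin`-index `0`). -/
def ind (S : Finset (TorusSite 3 L)) : TensorIndex (TorusSite 3 L) 2 :=
  fun z => if z ∈ S then 0 else 1

/-- The (real part of the) amplitude of a vector on the set `S`: `φ(S) = Re ψ(1_S)`. -/
def amp (ψ : TensorIndex (TorusSite 3 L) 2 → ℂ) (S : Finset (TorusSite 3 L)) : ℝ :=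
  (ψ (ind S)).re

/-- The ONE-particle insertion field `u^T_x = [x ∉ T] Re ψ(1_{T ∪ x})` (background `T`, the induction's
auxiliary object; the crux's two-particle field is `Negative.field ψ T x = Σ_y [x,y ∉ T, x ≠ y] φ(T∪{x,y})`). -/
def field1 (ψ : TensorIndex (TorusSite 3 L) 2 → ℂ) (T : Finset (TorusSite 3 L)) (x : TorusSite 3 L) : ℝ :=
  if x ∉ T then amp ψ (insert x T) else 0

variable [NeZero L]

/-- **The Penrose–Onsager trial vector** `Φ = A†ψ' = Σ_x a†_x ψ'` (insert one flat hard-core boson):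
`Φ(σ) = Σ_{x : σ_x = 0} ψ'(σ with x emptied)`, i.e. `Φ(1_S) = Σ_{u ∈ S} ψ'(1_{S ∖ u})`. -/
def poVec (ψ' : TensorIndex (TorusSite 3 L) 2 → ℂ) : TensorIndex (TorusSite 3 L) 2 → ℂ :=
  fun σ => ∑ x, if σ x = 0 then ψ' (Function.update σ x 1) else 0

/-- The quadratic form `Re ⟨Φ, HΦ⟩` of `xyTorus 3 L 1`. -/
def qform (Φ : TensorIndex (TorusSite 3 L) 2 → ℂ) : ℝ :=
  (star Φ ⬝ᵥ (xyTorus 3 L 1).mulVec Φ).re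

/-- `‖Φ‖² = Re ⟨Φ, Φ⟩`. -/
def nsq (Φ : TensorIndex (TorusSite 3 L) 2 → ℂ) : ℝ :=
  (star Φ ⬝ᵥ Φ).re

/-- The cosh gap of two amplitude pairs: with `e^{h} = b/a`, `e^{h'} = b'/a'`,
`coshGap a b a' b' = a·a'·(cosh(h - h') - 1) = (b a' - a b')² / (2 b b')` (polynomial form; Lean's
`x/0 = 0` only matters off the support, where admissible data never vanish by Perron–Frobenius). -/
def coshGap (a b a' b' : ℝ) : ℝ :=
  (b * a' - a * b') ^ 2 / (2 * b * b')

/-- **Edge cosh-discrepancy** between `ψ` (amplitudes `b = amp ψ`) and a trial vector `Φ`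
(`a = amp Φ`) at level `N`: `Σ_{directed token edges S → S - a + b} Φ(S)Φ(S')(cosh ∇(log ψ - log Φ) - 1)`,
edges = nearest-neighbour hops `a ∈ S`, `b ∉ S`, `a ∼ b` on the torus graph. -/
def edgeDisc (Φ ψ : TensorIndex (TorusSite 3 L) 2 → ℂ) (N : ℕ) : ℝ :=
  ∑ S ∈ (univ : Finset (TorusSite 3 L)).powersetCard N, ∑ a ∈ S, ∑ b,
    if b ∉ S ∧ (torusGraph 3 L).Adj a b then
      coshGap (amp Φ S) (amp ψ S) (amp Φ (insert b (S.erase a))) (amp ψ (insert b (S.erase a)))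
    else 0

/-- **Within-background (relocation) cosh-discrepancy** at level `N`: backgrounds `T` of `N - 1`
particles, the inserted particle relocated ANYWHERE, `x → x'`, weights `Φ(T∪x)Φ(T∪x')`:
`Σ_T Σ_{x,x' ∉ T} Φ(T∪x)Φ(T∪x')(cosh(h(T∪x) - h(T∪x')) - 1)`, `h = log amp ψ - log amp Φ`. -/
def disc (Φ ψ : TensorIndex (TorusSite 3 L) 2 → ℂ) (N : ℕ) : ℝ :=
  ∑ T ∈ (univ : Finset (TorusSite 3 L)).powersetCard (N - 1), ∑ x, ∑ x',
    if x ∉ T ∧ x' ∉ T then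
      coshGap (amp Φ (insert x T)) (amp ψ (insert x T)) (amp Φ (insert x' T)) (amp ψ (insert x' T))
    else 0

/-- The normaliser of `disc`: `Σ_{|T| = N-1} (Σ_{x ∉ T} Φ(T ∪ x))²` (total weight of the relocation law). -/
def wdisc (Φ : TensorIndex (TorusSite 3 L) 2 → ℂ) (N : ℕ) : ℝ :=
  ∑ T ∈ (univ : Finset (TorusSite 3 L)).powersetCard (N - 1), (∑ x, field1 Φ T x) ^ 2

end Vocabulary

section Levels

/-- The one-particle twin of `Negative.K1Ineq`: `L³ · Σ_{|T| = N-1} ‖u^T‖²Φ(u^T) ≤ M · Σ_T ‖u^T‖²`,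
same functional `K1lhs`/`K1rhs`, backgrounds of `N - 1` particles. -/
def K1IneqOne (M : ℝ) (L : ℕ) [NeZero L] (N : ℕ) (ψ : TensorIndex (TorusSite 3 L) 2 → ℂ) : Prop :=
  (L : ℝ) ^ 3 * ∑ T ∈ (univ : Finset (TorusSite 3 L)).powersetCard (N - 1), K1lhs (field1 ψ T) ≤
    M * ∑ T ∈ (univ : Finset (TorusSite 3 L)).powersetCard (N - 1), K1rhs (field1 ψ T)

/-- The sector-`N` ground energy `E(N)` of `xyTorus 3 L 1` (sector `S³_tot = N - L³/2`). -/
def secE (L : ℕ) [NeZero L] (N : ℕ) : ℝ :=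
  lowestEnergyInSector 1 (xyTorus 3 L 1) ((N : ℝ) - (L : ℝ) ^ 3 / 2)

/-- Admissible datum of the crux at level `N`: a nonzero, entrywise real-nonnegative sector-`N` vector
with `Hψ = E(N)ψ` — EXACTLY the four hypotheses of the crux (no positivity, no uniqueness assumed). -/
def IsGround (L : ℕ) [NeZero L] (N : ℕ) (ψ : TensorIndex (TorusSite 3 L) 2 → ℂ) : Prop :=
  ψ ∈ spinZSector 1 ((N : ℝ) - (L : ℝ) ^ 3 / 2) ∧ ψ ≠ 0 ∧
    (xyTorus 3 L 1).mulVec ψ =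
      ((lowestEnergyInSector 1 (xyTorus 3 L 1) ((N : ℝ) - (L : ℝ) ^ 3 / 2) : ℝ) : ℂ) • ψ ∧
    ∀ σ, 0 ≤ (ψ σ).re ∧ (ψ σ).im = 0

/-- "K1 at level `(L, N)` with constant `M`": the crux inequality for every admissible datum. -/
def K1Level (M : ℝ) (L : ℕ) [NeZero L] (N : ℕ) : Prop :=
  ∀ ψ : TensorIndex (TorusSite 3 L) 2 → ℂ, IsGround L N ψ → K1Ineq M L N ψ

/-- The one-particle twin of `K1Level`. -/
def K1LevelOne (M : ℝ) (L : ℕ) [NeZero L] (N : ℕ) : Prop :=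
  ∀ ψ : TensorIndex (TorusSite 3 L) 2 → ℂ, IsGround L N ψ → K1IneqOne M L N ψ

end Levels

/-! ### Rates of the induction (explicit, summable over the particle number uniformly in `L`) -/

/-- The additive slack allowed per level at the upper level `k` on the side-`L` torus:
`1/k² + 1/√(k·L³)` — few-body lattice effects plus the PESSIMISTIC (unscreened `a/r` tails up to the
healing length `ξ ≍ ν^{-1/2}`) count `a²ξ/L³ = O(1/√(k L³))` of the first-order profile cross term; it
dominates `1/L³`. `Σ_{k ≤ L³/2} slack ≤ 1/2 + 2` uniformly in `L` (any member `k^{-a}L^{-3(1-a)}`, `a < 1`,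
of the boundary family would do for the composition). -/
def slack (L k : ℕ) : ℝ :=
  1 / (k : ℝ) ^ 2 + 1 / Real.sqrt ((k : ℝ) * (L : ℝ) ^ 3)

/-- PO-averaging loss factor at the upper level `k`: `1 + C · slack`. -/
def lossA (C : ℝ) (L k : ℕ) : ℝ :=
  1 + C * slack L k

/-- Transport loss factor at the upper level `k` with relocation discrepancy `η`:
`1 + C (η + slack)`. -/
def lossT (C η : ℝ) (L k : ℕ) : ℝ :=
  1 + C * (η + slack L k)

/-- The relocation discrepancy the budget pays for at level `k`: `η = C · L²√L / (k · L³)`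
(`C = 2 C_P C_B`; `= C/(k√L)`). -/
def etaOf (C : ℝ) (L k : ℕ) : ℝ :=
  C * ((L : ℝ) ^ 2 * Real.sqrt L) / ((k : ℝ) * (L : ℝ) ^ 3)

/-! ## Stub statements -/

section Sig

/-- Stub 1 (BASE, two-body problem on the torus; provable now, M): at `N = 2` the unique (Perron)
sector ground vector is `φ({x,y}) = f(x - y)`, so the two-particle insertion field `r^∅_x = Σ_{v ≠ 0} f(v)`
is EXACTLY flat (`K1` with constant `2`, equality) and the one-particle profile at background `{t}` is the
pair function `x ↦ f(x - t)`, whose flatness functional is `≤ 2·(8/7)·f_max/f_min < 4` (`L = 2`: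
`f ∝ (2, √7, 3)` at distances `1,2,3`, value `2.37`; `L → ∞`: `→ 2`; ED j011992: `2.370, 2.101, 2.046, 2.026` for
`L = 2, 3, 4, 5`). -/
def Sig.stub_twoBodyBase : Prop :=
  ∀ (L : ℕ) [NeZero L], 2 ≤ L → K1Level 2 L 2 ∧ K1LevelOne 4 L 2

/-- Stub 2 (PO AVERAGING = card (B4), joint form; finite combinatorics of `A†` + one law-mismatch
estimate, L): the two insertion fields of `Φ = poVec ψ'` at level `N + 1` are positive mixtures
`r^T[Φ] = R'_T·1 + (L³ - 2N) u'^T + Σ_{z∈T} r'^{T∖z}` and `u^T[Φ] = ψ'(T)·1 + Σ_{z∈T} u'^{T∖z}` of a flat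
field and of level-`N` fields of `ψ'` (restricted to `Tᶜ`); the flatness functional of a positive mixture
is at most the max over its components (Minkowski in `ℓ³`, `‖·‖² ≥ (Σ)²/#supp`), and the `ω`-law of the
deleted backgrounds `T ∖ z` differs from the level-`N` law by an insertion-weight tilt whose covariance
with the flatness functional is `O(slack)` (both are spatial averages of local functionals of a clustering
state); the floor moves by `(L³-N+3)/(L³-N+2) ≤ 1 + 2/L³`. Hence constant `max(M, M₁)·(1 + C_A·slack L (N+1))`
for BOTH functionals of `Φ`. Toy j011617 (ED, `3³,4³,5³,4²,6²,8²`, rings): `poLoss·L³ = Q(Φ_{N+1})/Q(ψ_N) - 1`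
times `L³` is `0.8–1.3` at every `(L,N)` reached (it IS the floor shift), and the EXCESS over the floor
CONTRACTS, `exΦ/exPrev = 0.37–0.63`; with the one-particle functional (j011992; `Q₁ > Q` everywhere, so `max(M,M₁) = M₁`)
`poLossMax·L³ = 0.83, 0.74, 0.72, 0.74, 0.77` (`3³`), `0.68, 0.50` (`4³`), `0.52` (`5³`). (Why it might fail: an adverse `O(1/N)` covariance between the deletion
tilt and the level-`N` flatness functional at fillings/sizes beyond ED reach — then only `max(M,M₁)(1 + C/N)`
holds and the product over `N` diverges.) -/
def Sig.stub_poAveraging : Prop :=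
  ∃ C_A : ℝ, 0 ≤ C_A ∧ ∀ (L : ℕ) [NeZero L], 3 ≤ L → ∀ N : ℕ, 2 ≤ N → 2 * (N + 1) ≤ L ^ 3 →
    ∀ (M M₁ : ℝ) (ψ' : TensorIndex (TorusSite 3 L) 2 → ℂ), IsGround L N ψ' →
      K1Ineq M L N ψ' → K1IneqOne M₁ L N ψ' →
      K1Ineq (max M M₁ * lossA C_A L (N + 1)) L (N + 1) (poVec ψ') ∧
      K1IneqOne (max M M₁ * lossA C_A L (N + 1)) L (N + 1) (poVec ψ')

/-- Stub 3 (the COSH-BUDGET IDENTITY — the card's lever; exact, provable now, M): for the level-`N+1`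
ground vector `ψ` (amplitudes `φ > 0` on `(N+1)`-sets by Perron–Frobenius, constant local energy
`Σ_{S' ∼ S} φ(S') = -2E(N+1) φ(S)`) and the PO vector `Φ` (positive on `(N+1)`-sets), pairing the
eigen-equation against `Φ(S)²/φ(S)` and symmetrising each undirected token edge
(`Φ²φ'/φ + Φ'²φ/φ' = 2ΦΦ' cosh ∇h`, `h = log φ - log Φ`) gives
`Σ_{dir} ΦΦ' cosh ∇h = -2E(N+1) Σ_S Φ(S)²`, and `Σ_{dir} ΦΦ' = -2⟨Φ,HΦ⟩` (matrix elements `-½` on hops,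
`0` diagonal), whence `edgeDisc Φ ψ (N+1) = 2(⟨Φ,HΦ⟩ - E(N+1)‖Φ‖²)` — the variational excess of `Φ` IS the
`Φ⊗Φ`-weighted cosh-discrepancy of `log ψ - log Φ`. (Holds for every `Φ` positive on `(N+1)`-sets; ED
check j009506: `5e-12`.) -/
def Sig.stub_coshBudgetIdentity : Prop :=
  ∀ (L : ℕ) [NeZero L], 3 ≤ L → ∀ N : ℕ, 1 ≤ N → 2 * (N + 1) ≤ L ^ 3 →
    ∀ ψ ψ' : TensorIndex (TorusSite 3 L) 2 → ℂ, IsGround L (N + 1) ψ → IsGround L N ψ' →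
      edgeDisc (poVec ψ') ψ (N + 1) = 2 * (qform (poVec ψ') - secE L (N + 1) * nsq (poVec ψ'))

/-- Stub 4 (PO BUDGET = card (B2⁺) at the exponent fixed by triage r1-3; the line's variational bet, XL):
the TOTAL variational excess of the Penrose–Onsager vector is `O(L⁻³)` (one `L³`-th of the bandwidth),
uniformly in the filling `≤ ½`: `⟨Φ,HΦ⟩ - E(N+1)‖Φ‖² ≤ (C_B/L³)‖Φ‖²`, `Φ = poVec ψ'`. Exact handle:
`[H, A†] = -3A† + Σ_u a_u† m_u` gives `E_Φ - E(N+1) = E_{Φ²}[m̄] - E_{φΦ}[m̄] = -Cov_{Φ²}(m̄, e^h)/E_{Φ²}e^h`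
(`m̄ ∈ [0,6]` the removal-weighted contact number): the excess is a covariance of one bounded local
observable; Bogoliubov counting (`a₀†ψ_N` has parameters off by `O(1/N)`, energy stationary) and the
toy (`(E_Φ - E)·L³ = 0.95, 1.16, 1.19, 1.15, 1.09` at `L = 3`, `N+1 = 2…6`; `1.14, 1.45, 1.57` at `L = 4`)
say `O(1/L³)`. Unconditionally only `≤ C(N+1)/L³` is cheap (`POTrialExcessBound`, via
`ChemicalPotentialExcessBound` `δ ≤ 12ν` from sector-energy convexity — the rank-2 ENGINE, not item 9672).
(Why it might fail: a variational statement of `O(1/L³)` ABSOLUTE precision relative to the exact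
`E(N+1)`; its natural proof (`H₋₁`-norm of the centred contact number under the PO Doob dynamics)
presupposes Kipnis–Varadhan control of the `N`-body ground-state process.) -/
def Sig.stub_poExcessBudget : Prop :=
  ∃ C_B : ℝ, 0 ≤ C_B ∧ ∀ (L : ℕ) [NeZero L], 3 ≤ L → ∀ N : ℕ, 1 ≤ N → 2 * (N + 1) ≤ L ^ 3 →
    ∀ ψ' : TensorIndex (TorusSite 3 L) 2 → ℂ, IsGround L N ψ' →
      qform (poVec ψ') - secE L (N + 1) * nsq (poVec ψ') ≤ C_B / (L : ℝ) ^ 3 * nsq (poVec ψ')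

/-- Stub 5 (RELOCATION POINCARÉ = card (B3) in cosh form, at the affordable scale `L`; L): the
within-background relocation cosh-discrepancy is controlled by the nearest-neighbour (token-edge)
cosh-discrepancy through canonical paths on the punctured torus `Tᶜ` (length `≤ 3L/2`, congestion
`≍ L`), weighted by the PO insertion amplitudes `Φ(T ∪ ·)` — whose one-step ratios near contacts are
bounded below one lattice step deep (the only pointwise regularity used) — and by the one-step Harnack
bound `|∇h| ≤ 2 log(12(N+1))` that upgrades second to exponential moments along paths; the kinetic
normalisation `Σ_{dir} ΦΦ' = -2⟨Φ,HΦ⟩ ≥ 3(N+1)(1-ν)‖Φ‖² - O(L⁻³)‖Φ‖²` is folded in: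
`disc·‖Φ‖²·(N+1) ≤ C_P · L²√L · edgeDisc · wdisc`, i.e. per unit weight
`E_reloc[cosh Δh - 1] ≤ C_P L^{5/2} · E_edge[cosh ∇h - 1] · ‖Φ‖²·6(N+1)/Σ_dir ΦΦ'`. Any exponent `< 3`
of `L` would do for the composition (`L^{5/2}` leaves `L^{o(1)}` room over the card's `L^{2+o(1)}`).
(Why it might fail: exponential (not quadratic) moments must be chained over `≍ L` steps — rare edges
with `|∇h| ≍ log N` could dominate `cosh` of a path sum even though their edge budget is tiny; the bet is
the bounded-increment (Harnack) + small-variance combination.) -/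
def Sig.stub_relocationPoincare : Prop :=
  ∃ C_P : ℝ, 0 ≤ C_P ∧ ∀ (L : ℕ) [NeZero L], 3 ≤ L → ∀ N : ℕ, 1 ≤ N → 2 * (N + 1) ≤ L ^ 3 →
    ∀ ψ ψ' : TensorIndex (TorusSite 3 L) 2 → ℂ, IsGround L (N + 1) ψ → IsGround L N ψ' →
      disc (poVec ψ') ψ (N + 1) * nsq (poVec ψ') * ((N : ℝ) + 1) ≤
        C_P * ((L : ℝ) ^ 2 * Real.sqrt L) * edgeDisc (poVec ψ') ψ (N + 1) * wdisc (poVec ψ') (N + 1)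

/-- Stub 6 (DISCREPANCY TRANSPORT — the HARDEST stub; XL): if the PO vector `Φ` is flat at level `N+1`
(both functionals) and the within-background cosh-discrepancy of `h = log ψ - log Φ` is `≤ η` per unit
weight, then `ψ = Φ·e^h` is flat with constant `max(M,M₁)·(1 + C_T(η + slack L (N+1)))`. Mechanism and
numbers (toy j011617, `trLoss = Q(ψ)/Q(Φ) - 1 = tilt + prof`):
(i) PROFILE — per background `T` the flatness functional depends only on the conditional insertion law
given `T`, which `e^h` tilts by within-`T` differences of `h` only. The PO discrepancy field is EXPLICIT one
pair-factor deep: for `x` at distance `r` from a background particle, `h(T∪x) - h̄ ≈ -log(1 - 2/N + 2/(N f(r)))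
≈ -(2/N)(1/f(r) - 1)` (two of the `N+1` summands of `Φ` lack the pair factor `f`), i.e. amplitude `O(1/N)`
supported near the `N` particles; so the FIRST-order cross term `Cov_x(δ_Φ, δh)` is `N × O(1/N) × O(v₀/L³) =
O(1/L³)` per level (pessimistically `O(a²ξ/L³) = O(1/√(N L³))` with unscreened `a/r` tails, whence `slack`),
and the second-order / large-deviation part is `O(η)` (cosh moments for the cubic term). ED: `prof·L³ =
0.23, 0.36, 0.42, 0.46, 0.47` (`3³`, `N+1 = 3…7`), `0.36, 0.58` (`4³`), `0.53` (`5³`); `η_y·(N+1)·L³ ≈ 1.2` constant.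
(ii) TILT — the `ω`-weights of the background are tilted by `t_T = ‖r^T[ψ]‖²/‖r^T[Φ]‖² ≈ e^{2h̄_T}` (triage
r1-1/r1-2). `h̄_T` is translation invariant (no linear density mode `k ≠ 0`) and the covariance of `t_T` with
the translation-invariant, spatially averaged flatness functional is a structure-factor sum in which the
`O(1/N)` relative difference between the short-range correlations of `ψ_{N+1}` and `Φ_{N+1}` is spread over all
modes: ED `tilt = -1e-4 … -5e-4`, NEGATIVE (the true law weights flatter backgrounds) and two orders below
`prof`; `σ(h̄)`-order terms (`varh ≈ 1e-2`) do not appear. One-particle functional (j011992): `trLossMax·L³/L = 0.10,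
0.17, 0.20, 0.22, 0.22, 0.22` (`3³`, `N+1 = 2…7`), `0.11, 0.19, 0.23` (`4³`), `0.13, 0.22` (`5³`): `≈ 0.22/L²` per level in the
UNSCREENED few-body regime (`k ≲ L/(8πa)`; covered by the `1/k²` part of `slack`) crossing over to `≍ 0.08/√(kL³)` once `ξ_k < L`.
(Why it might fail: if beyond ED sizes `Cov_ω(X_T, t_T)` or the profile cross term is only `o(1)` per level
and not `O(η + slack)`, the loss is not summable and the induction yields `M_N → ∞` — this is where lattice
BEC off half filling would hide; the global variance of `h` (`≍ 1/L` per level) must never enter, in any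
order.) -/
def Sig.stub_discrepancyTransport : Prop :=
  ∃ C_T : ℝ, 0 ≤ C_T ∧ ∀ (L : ℕ) [NeZero L], 3 ≤ L → ∀ N : ℕ, 1 ≤ N → 2 * (N + 1) ≤ L ^ 3 →
    ∀ ψ ψ' : TensorIndex (TorusSite 3 L) 2 → ℂ, IsGround L (N + 1) ψ → IsGround L N ψ' →
      ∀ M M₁ η : ℝ, 0 ≤ η →
        K1Ineq M L (N + 1) (poVec ψ') → K1IneqOne M₁ L (N + 1) (poVec ψ') →
        disc (poVec ψ') ψ (N + 1) ≤ η * wdisc (poVec ψ') (N + 1) →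
        K1Ineq (max M M₁ * lossT C_T η L (N + 1)) L (N + 1) ψ ∧
        K1IneqOne (max M M₁ * lossT C_T η L (N + 1)) L (N + 1) ψ

end Sig

/-! ## Registered stubs (the ONLY `sorry`s of this file) -/

/-- Stub 1 — base of the induction (two-body problem). [folklore] -/
theorem stub_twoBodyBase : Sig.stub_twoBodyBase := by
  sorry

/-- Stub 2 — PO averaging (B4, joint one- and two-particle form). [folklore] -/
theorem stub_poAveraging : Sig.stub_poAveraging := by
  sorry

/-- Stub 3 — the cosh-budget identity (exact). [folklore] -/
theorem stub_coshBudgetIdentity : Sig.stub_coshBudgetIdentity := by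
  sorry

/-- Stub 4 — the Penrose–Onsager budget `O(L⁻³)` (B2⁺). [folklore] -/
theorem stub_poExcessBudget : Sig.stub_poExcessBudget := by
  sorry

/-- Stub 5 — relocation Poincaré inequality in cosh form (B3). [folklore] -/
theorem stub_relocationPoincare : Sig.stub_relocationPoincare := by
  sorry

/-- Stub 6 — discrepancy transport (profile + tilt; the hardest stub). [folklore] -/
theorem stub_discrepancyTransport : Sig.stub_discrepancyTransport := by
  sorry

/-! ## Glue (sorry-free) -/

section Glue

variable {L : ℕ} [NeZero L]

/-- Monotonicity of the crux inequality in the constant. [folklore] -/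
theorem K1Ineq_mono {M M' : ℝ} (hMM' : M ≤ M') {N : ℕ} {ψ : TensorIndex (TorusSite 3 L) 2 → ℂ}
    (h : K1Ineq M L N ψ) : K1Ineq M' L N ψ := by
  unfold K1Ineq at h ⊢
  refine h.trans (mul_le_mul_of_nonneg_right hMM' ?_)
  exact Finset.sum_nonneg fun T _ => Finset.sum_nonneg fun x _ => sq_nonneg _

/-- Monotonicity of the one-particle inequality in the constant. [folklore] -/
theorem K1IneqOne_mono {M M' : ℝ} (hMM' : M ≤ M') {N : ℕ} {ψ : TensorIndex (TorusSite 3 L) 2 → ℂ}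
    (h : K1IneqOne M L N ψ) : K1IneqOne M' L N ψ := by
  unfold K1IneqOne at h ⊢
  refine h.trans (mul_le_mul_of_nonneg_right hMM' ?_)
  exact Finset.sum_nonneg fun T _ => Finset.sum_nonneg fun x _ => sq_nonneg _

/-- Existence of an admissible datum at every level `N ≤ L³` (landed Perron–Frobenius EXISTENCE,
`Negative.exists_nonneg_sectorGroundState_xyTorus`). [folklore] -/
theorem exists_isGround (N : ℕ) (hN : N ≤ L ^ 3) :
    ∃ ψ : TensorIndex (TorusSite 3 L) 2 → ℂ, IsGround L N ψ := by
  obtain ⟨ψ, hne, hnn, hsec, heig⟩ := exists_nonneg_sectorGroundState_xyTorus 3 L N hN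
  exact ⟨ψ, hsec, hne, heig, hnn⟩

/-- An admissible datum charges some `N`-set: `Re ψ(1_S) > 0` with `|S| = N` (landed
`Negative.exists_occSet_pos`). [folklore] -/
theorem exists_amp_pos {N : ℕ} {ψ : TensorIndex (TorusSite 3 L) 2 → ℂ} (hψ : IsGround L N ψ) :
    ∃ S : Finset (TorusSite 3 L), S.card = N ∧ 0 < amp ψ S := by
  obtain ⟨hsec, hne, -, hnn⟩ := hψ
  obtain ⟨S, hS, hpos⟩ := exists_occSet_pos ψ N ((N : ℝ) - (L : ℝ) ^ 3 / 2)
    (by rw [card_torusSite 3 L]; push_cast; ring) hsec hne hnn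
  exact ⟨S, hS, hpos⟩

omit [NeZero L] in
/-- Emptying the site `x ∉ S` of `1_{S ∪ x}` gives `1_S`. [folklore] -/
theorem update_ind_insert {S : Finset (TorusSite 3 L)} {x : TorusSite 3 L} (hx : x ∉ S) :
    Function.update (ind (insert x S)) x 1 = ind S := by
  funext z
  by_cases hz : z = x
  · subst hz
    simp [ind, hx]
  · rw [Function.update_of_ne hz]
    simp [ind, hz]

/-- **The PO vector of an admissible level-`N` datum is nonzero** for `N < L³`:
`Re Φ(1_{S ∪ x}) ≥ Re ψ'(1_S) > 0` for a charged `S` and any `x ∉ S`. [folklore] -/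
theorem nsq_poVec_pos {N : ℕ} {ψ' : TensorIndex (TorusSite 3 L) 2 → ℂ} (hψ' : IsGround L N ψ')
    (hN : N < L ^ 3) : 0 < nsq (poVec ψ') := by
  obtain ⟨S, hS, hpos⟩ := exists_amp_pos hψ'
  obtain ⟨-, -, -, hnn⟩ := hψ'
  -- a free site
  obtain ⟨x, hx⟩ : ∃ x : TorusSite 3 L, x ∉ S := by
    by_contra h
    push Not at h
    have hSu : S = Finset.univ := Finset.eq_univ_iff_forall.mpr h
    have : Fintype.card (TorusSite 3 L) = N := by rw [← hS, hSu, Finset.card_univ]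
    rw [card_torusSite 3 L] at this
    rw [this] at hN
    exact lt_irrefl N hN
  set σ : TensorIndex (TorusSite 3 L) 2 := ind (insert x S) with hσ
  -- the entry of `Φ` at `1_{S ∪ x}` has positive real part
  have hterm : ∀ y : TorusSite 3 L,
      0 ≤ ((if σ y = 0 then ψ' (Function.update σ y 1) else 0 : ℂ)).re := by
    intro y
    split_ifs
    · exact (hnn _).1
    · simp
  have hxterm : ((if σ x = 0 then ψ' (Function.update σ x 1) else 0 : ℂ)).re = amp ψ' S := by
    have hσx : σ x = 0 := by simp [hσ, ind]
    rw [if_pos hσx, hσ, update_ind_insert hx]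
    rfl
  have hre : 0 < (poVec ψ' σ).re := by
    simp only [poVec, Complex.re_sum]
    calc (0 : ℝ) < amp ψ' S := hpos
      _ = ((if σ x = 0 then ψ' (Function.update σ x 1) else 0 : ℂ)).re := hxterm.symm
      _ ≤ ∑ y, ((if σ y = 0 then ψ' (Function.update σ y 1) else 0 : ℂ)).re :=
          Finset.single_le_sum (f := fun y => ((if σ y = 0 then ψ' (Function.update σ y 1) else 0 : ℂ)).re)
            (fun y _ => hterm y) (Finset.mem_univ x)
  -- hence `‖Φ‖² > 0`
  have hsum : nsq (poVec ψ') = ∑ τ, Complex.normSq (poVec ψ' τ) := by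
    rw [nsq, dotProduct, Complex.re_sum]
    refine Finset.sum_congr rfl fun τ _ => ?_
    rw [Pi.star_apply, Complex.star_def, ← Complex.normSq_eq_conj_mul_self, Complex.ofReal_re]
  rw [hsum]
  refine lt_of_lt_of_le ?_ (Finset.single_le_sum (f := fun τ => Complex.normSq (poVec ψ' τ))
    (fun τ _ => Complex.normSq_nonneg _) (Finset.mem_univ σ))
  have : poVec ψ' σ ≠ 0 := fun h => by
    rw [h, Complex.zero_re] at hre
    exact lt_irrefl _ hre
  exact Complex.normSq_pos.mpr this

end Glue

/-! ### Arithmetic of the rates -/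

section Arithmetic

/-- `Σ_{k=3}^{n} 1/k² ≤ 1/2 - 1/n` for `n ≥ 2` (telescoping `1/k² ≤ 1/(k-1) - 1/k`). [folklore] -/
theorem sum_inv_sq_le_aux (n : ℕ) (hn : 2 ≤ n) :
    ∑ k ∈ Icc 3 n, 1 / (k : ℝ) ^ 2 ≤ 1 / 2 - 1 / (n : ℝ) := by
  induction n, hn using Nat.le_induction with
  | base =>
    rw [Finset.Icc_eq_empty (by omega), Finset.sum_empty]
    norm_num
  | succ n hn ih =>
    rw [Finset.sum_Icc_succ_top (by omega)]
    have hn0 : (0 : ℝ) < n := by exact_mod_cast (by omega : 0 < n)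
    have key : 1 / ((n + 1 : ℕ) : ℝ) ^ 2 ≤ 1 / (n : ℝ) - 1 / ((n + 1 : ℕ) : ℝ) := by
      push_cast
      rw [div_sub_div _ _ hn0.ne' (by positivity), div_le_div_iff₀ (by positivity) (by positivity)]
      nlinarith
    linarith

/-- `Σ_{k=3}^{n} 1/k² ≤ 1/2` for every `n`. [folklore] -/
theorem sum_inv_sq_le (n : ℕ) : ∑ k ∈ Icc 3 n, 1 / (k : ℝ) ^ 2 ≤ 1 / 2 := by
  by_cases hn : 2 ≤ n
  · have h := sum_inv_sq_le_aux n hn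
    have : (0 : ℝ) ≤ 1 / (n : ℝ) := by positivity
    linarith
  · rw [Finset.Icc_eq_empty (by omega), Finset.sum_empty]
    norm_num

/-- `Σ_{k=3}^{n} 1/k ≤ log n` for `n ≥ 2` (`1/(k+1) ≤ log(k+1) - log k`). [folklore] -/
theorem sum_inv_le_log (n : ℕ) (hn : 2 ≤ n) :
    ∑ k ∈ Icc 3 n, 1 / (k : ℝ) ≤ Real.log n := by
  induction n, hn using Nat.le_induction with
  | base =>
    rw [Finset.Icc_eq_empty (by omega), Finset.sum_empty]
    exact Real.log_nonneg (by norm_num)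
  | succ n hn ih =>
    rw [Finset.sum_Icc_succ_top (by omega)]
    have hn0 : (0 : ℝ) < n := by exact_mod_cast (by omega : 0 < n)
    have hn1 : (0 : ℝ) < (n : ℝ) + 1 := by linarith
    have key : 1 / ((n + 1 : ℕ) : ℝ) ≤ Real.log ((n + 1 : ℕ) : ℝ) - Real.log n := by
      push_cast
      have h := Real.one_sub_inv_le_log_of_pos (x := ((n : ℝ) + 1) / n) (by positivity)
      rw [Real.log_div hn1.ne' hn0.ne', inv_div] at h
      have hn1' : (n : ℝ) + 1 ≠ 0 := hn1.ne'
      have h2 : 1 - (n : ℝ) / ((n : ℝ) + 1) = 1 / ((n : ℝ) + 1) := by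
        field_simp
        ring
      linarith
    linarith

/-- `Σ_{k=3}^{n} 1/√k ≤ 2√n` (`1/√(k+1) ≤ 2(√(k+1) - √k)`). [folklore] -/
theorem sum_inv_sqrt_le (n : ℕ) (hn : 2 ≤ n) :
    ∑ k ∈ Icc 3 n, 1 / Real.sqrt k ≤ 2 * Real.sqrt n := by
  induction n, hn using Nat.le_induction with
  | base =>
    rw [Finset.Icc_eq_empty (by omega), Finset.sum_empty]
    positivity
  | succ n hn ih =>
    rw [Finset.sum_Icc_succ_top (by omega)]
    push_cast
    set s := Real.sqrt ((n : ℝ) + 1) with hs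
    set t := Real.sqrt (n : ℝ) with ht
    have hs2 : s ^ 2 = (n : ℝ) + 1 := Real.sq_sqrt (by positivity)
    have ht2 : t ^ 2 = (n : ℝ) := Real.sq_sqrt (by positivity)
    have hspos : 0 < s := Real.sqrt_pos.2 (by positivity)
    have key : 1 / s ≤ 2 * s - 2 * t := by
      rw [div_le_iff₀ hspos]
      nlinarith [sq_nonneg (s - t)]
    linarith

/-- `Σ_{k=3}^{n} slack L k ≤ 5/2` for `2 ≤ n ≤ L³`. [folklore] -/
theorem sum_slack_le (L : ℕ) (hL : 1 ≤ L) (n : ℕ) (hn : 2 ≤ n) (hnL : n ≤ L ^ 3) :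
    ∑ k ∈ Icc 3 n, slack L k ≤ 5 / 2 := by
  unfold slack
  rw [Finset.sum_add_distrib]
  have h1 := sum_inv_sq_le n
  have hV0 : 0 < Real.sqrt ((L : ℝ) ^ 3) := Real.sqrt_pos.2 (by positivity)
  have hrw : ∀ k ∈ Icc 3 n, 1 / Real.sqrt ((k : ℝ) * (L : ℝ) ^ 3) =
      1 / Real.sqrt k * (1 / Real.sqrt ((L : ℝ) ^ 3)) := by
    intro k _
    rw [Real.sqrt_mul (Nat.cast_nonneg k), one_div_mul_one_div]
  rw [Finset.sum_congr rfl hrw, ← Finset.sum_mul]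
  have h2 := sum_inv_sqrt_le n hn
  have hsq : Real.sqrt (n : ℝ) ≤ Real.sqrt ((L : ℝ) ^ 3) := Real.sqrt_le_sqrt (by exact_mod_cast hnL)
  have h3 : (∑ k ∈ Icc 3 n, 1 / Real.sqrt (k : ℝ)) * (1 / Real.sqrt ((L : ℝ) ^ 3)) ≤ 2 :=
    calc (∑ k ∈ Icc 3 n, 1 / Real.sqrt (k : ℝ)) * (1 / Real.sqrt ((L : ℝ) ^ 3))
        ≤ 2 * Real.sqrt n * (1 / Real.sqrt ((L : ℝ) ^ 3)) :=
          mul_le_mul_of_nonneg_right h2 (by positivity)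
      _ = 2 * (Real.sqrt n / Real.sqrt ((L : ℝ) ^ 3)) := by ring
      _ ≤ 2 * 1 := mul_le_mul_of_nonneg_left ((div_le_one hV0).2 hsq) (by norm_num)
      _ = 2 := by ring
  linarith

/-- `log L ≤ 2√L` for `L ≥ 1`. [folklore] -/
theorem log_le_two_sqrt (x : ℝ) (hx : 1 ≤ x) : Real.log x ≤ 2 * Real.sqrt x := by
  have hs : 0 < Real.sqrt x := Real.sqrt_pos.mpr (by linarith)
  have h1 := Real.log_le_sub_one_of_pos hs
  have h2 : Real.log (Real.sqrt x) = Real.log x / 2 := Real.log_sqrt (by linarith)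
  linarith

/-- `Σ_{k=3}^{n} η_{L,k} ≤ 6 C` for `2 ≤ n ≤ L³`, `C ≥ 0`: the harmonic sum `≤ log L³ ≤ 6√L` against the
factor `L²√L/L³`. [folklore] -/
theorem sum_etaOf_le (C : ℝ) (hC : 0 ≤ C) (L : ℕ) (hL : 1 ≤ L) (n : ℕ) (hn : 2 ≤ n)
    (hnL : n ≤ L ^ 3) : ∑ k ∈ Icc 3 n, etaOf C L k ≤ 6 * C := by
  have hL0 : (0 : ℝ) < L := by exact_mod_cast (by omega : 0 < L)
  have hL1 : (1 : ℝ) ≤ L := by exact_mod_cast hL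
  have hsq : Real.sqrt (L : ℝ) * Real.sqrt L = L := Real.mul_self_sqrt hL0.le
  -- pull the `k`-free factor out
  have hrw : ∀ k ∈ Icc 3 n, etaOf C L k = C * ((L : ℝ) ^ 2 * Real.sqrt L) / (L : ℝ) ^ 3 * (1 / (k : ℝ)) := by
    intro k _
    rw [etaOf, div_mul_div_comm, mul_one, mul_comm ((L : ℝ) ^ 3) (k : ℝ)]
  rw [Finset.sum_congr rfl hrw, ← Finset.mul_sum]
  have hharm : ∑ k ∈ Icc 3 n, 1 / (k : ℝ) ≤ 6 * Real.sqrt L := by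
    refine (sum_inv_le_log n hn).trans ?_
    have hn0 : (0 : ℝ) < n := by exact_mod_cast (by omega : 0 < n)
    have h1 : Real.log n ≤ Real.log ((L : ℝ) ^ 3) :=
      Real.log_le_log hn0 (by exact_mod_cast hnL)
    rw [Real.log_pow] at h1
    have h2 := log_le_two_sqrt (L : ℝ) hL1
    push_cast at h1
    linarith
  have hfac : 0 ≤ C * ((L : ℝ) ^ 2 * Real.sqrt L) / (L : ℝ) ^ 3 := by positivity
  calc C * ((L : ℝ) ^ 2 * Real.sqrt L) / (L : ℝ) ^ 3 * ∑ k ∈ Icc 3 n, 1 / (k : ℝ)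
      ≤ C * ((L : ℝ) ^ 2 * Real.sqrt L) / (L : ℝ) ^ 3 * (6 * Real.sqrt L) :=
        mul_le_mul_of_nonneg_left hharm hfac
    _ = 6 * C * (((L : ℝ) ^ 2 * (Real.sqrt L * Real.sqrt L)) / (L : ℝ) ^ 3) := by ring
    _ = 6 * C := by
        rw [hsq, show (L : ℝ) ^ 2 * L = (L : ℝ) ^ 3 by ring, div_self (pow_ne_zero 3 hL0.ne'), mul_one]

/-- `Π_{k ∈ s} (1 + a_k)(1 + b_k) ≤ exp(Σ_{k∈s} (a_k + b_k))` for `a, b ≥ 0`. [folklore] -/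
theorem prod_one_add_mul_one_add_le_exp {s : Finset ℕ} {a b : ℕ → ℝ} (ha : ∀ k ∈ s, 0 ≤ a k)
    (hb : ∀ k ∈ s, 0 ≤ b k) :
    ∏ k ∈ s, (1 + a k) * (1 + b k) ≤ Real.exp (∑ k ∈ s, (a k + b k)) := by
  rw [Real.exp_sum]
  refine Finset.prod_le_prod (fun k hk => mul_nonneg (by linarith [ha k hk]) (by linarith [hb k hk]))
    fun k hk => ?_
  rw [Real.exp_add]
  have h1 : 1 + a k ≤ Real.exp (a k) := by linarith [Real.add_one_le_exp (a k)]
  have h2 : 1 + b k ≤ Real.exp (b k) := by linarith [Real.add_one_le_exp (b k)]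
  exact mul_le_mul h1 h2 (by linarith [hb k hk]) (Real.exp_pos _).le

end Arithmetic

/-! ### The induction -/

section Induction

/-- The per-level factor of the induction at the upper level `k` (constants `C_A, C_T` and
`C = 2 C_P C_B`). -/
def levelFactor (C_A C_T C : ℝ) (L k : ℕ) : ℝ :=
  lossA C_A L k * lossT C_T (etaOf C L k) L k

/-- The bound delivered at level `n`: `4 · Π_{k=3}^{n} levelFactor`. -/
def bnd (C_A C_T C : ℝ) (L n : ℕ) : ℝ :=
  4 * ∏ k ∈ Icc 3 n, levelFactor C_A C_T C L k

theorem bnd_two (C_A C_T C : ℝ) (L : ℕ) : bnd C_A C_T C L 2 = 4 := by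
  rw [bnd, Finset.Icc_eq_empty (by omega), Finset.prod_empty, mul_one]

theorem bnd_succ (C_A C_T C : ℝ) (L N : ℕ) (hN : 2 ≤ N) :
    bnd C_A C_T C L (N + 1) = bnd C_A C_T C L N * levelFactor C_A C_T C L (N + 1) := by
  rw [bnd, bnd, Finset.prod_Icc_succ_top (by omega), mul_assoc]

theorem etaOf_nonneg {C : ℝ} (hC : 0 ≤ C) (L k : ℕ) : 0 ≤ etaOf C L k := by
  unfold etaOf; positivity

/-- **Uniform bound of the product**: for `L ≥ 1` and `2 ≤ n`, `2n ≤ L³`,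
`bnd ≤ 4·exp((5/2)C_A + C_T(6C + 5/2))`. [folklore] -/
theorem bnd_le {C_A C_T C : ℝ} (hA : 0 ≤ C_A) (hT : 0 ≤ C_T) (hC : 0 ≤ C) (L : ℕ) (hL : 1 ≤ L)
    (n : ℕ) (hn : 2 ≤ n) (hnL : 2 * n ≤ L ^ 3) :
    bnd C_A C_T C L n ≤ 4 * Real.exp (5 / 2 * C_A + C_T * (6 * C + 5 / 2)) := by
  have hη : ∀ k, 0 ≤ etaOf C L k := fun k => etaOf_nonneg hC L k
  have hsl : ∀ k, 0 ≤ slack L k := fun k => by unfold slack; positivity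
  have ha0 : ∀ k ∈ Icc 3 n, 0 ≤ C_A * slack L k := fun k _ => mul_nonneg hA (hsl k)
  have hb0 : ∀ k ∈ Icc 3 n, 0 ≤ C_T * (etaOf C L k + slack L k) :=
    fun k _ => mul_nonneg hT (add_nonneg (hη k) (hsl k))
  have hprod := prod_one_add_mul_one_add_le_exp
    (a := fun k => C_A * slack L k) (b := fun k => C_T * (etaOf C L k + slack L k)) ha0 hb0
  have hunf : ∏ k ∈ Icc 3 n, levelFactor C_A C_T C L k =
      ∏ k ∈ Icc 3 n, (1 + C_A * slack L k) * (1 + C_T * (etaOf C L k + slack L k)) := rfl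
  unfold bnd
  rw [hunf]
  refine mul_le_mul_of_nonneg_left (hprod.trans (Real.exp_le_exp.mpr ?_)) (by norm_num)
  have hS := sum_slack_le L hL n hn (le_trans (by omega) hnL)
  have hE := sum_etaOf_le C hC L hL n hn (le_trans (by omega) hnL)
  simp only [mul_add, Finset.sum_add_distrib, ← Finset.mul_sum]
  have e1 := mul_le_mul_of_nonneg_left hS hA
  have e3 := mul_le_mul_of_nonneg_left hE hT
  have e4 := mul_le_mul_of_nonneg_left hS hT
  linarith

variable {L : ℕ} [NeZero L]

/-- **The induction.** Given the five level-dependent stubs with their constants, both flatness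
functionals hold at every level `2 ≤ n ≤ L³/2` with constant `bnd … L n` (`L ≥ 3`). [folklore] -/
theorem levels {C_A C_B C_P C_T : ℝ} (hCB : 0 ≤ C_B) (hCP : 0 ≤ C_P)
    (h₁ : Sig.stub_twoBodyBase)
    (hA : ∀ (L : ℕ) [NeZero L], 3 ≤ L → ∀ N : ℕ, 2 ≤ N → 2 * (N + 1) ≤ L ^ 3 →
      ∀ (M M₁ : ℝ) (ψ' : TensorIndex (TorusSite 3 L) 2 → ℂ), IsGround L N ψ' →
        K1Ineq M L N ψ' → K1IneqOne M₁ L N ψ' →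
        K1Ineq (max M M₁ * lossA C_A L (N + 1)) L (N + 1) (poVec ψ') ∧
        K1IneqOne (max M M₁ * lossA C_A L (N + 1)) L (N + 1) (poVec ψ'))
    (h₃ : Sig.stub_coshBudgetIdentity)
    (hB : ∀ (L : ℕ) [NeZero L], 3 ≤ L → ∀ N : ℕ, 1 ≤ N → 2 * (N + 1) ≤ L ^ 3 →
      ∀ ψ' : TensorIndex (TorusSite 3 L) 2 → ℂ, IsGround L N ψ' →
        qform (poVec ψ') - secE L (N + 1) * nsq (poVec ψ') ≤ C_B / (L : ℝ) ^ 3 * nsq (poVec ψ'))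
    (hP : ∀ (L : ℕ) [NeZero L], 3 ≤ L → ∀ N : ℕ, 1 ≤ N → 2 * (N + 1) ≤ L ^ 3 →
      ∀ ψ ψ' : TensorIndex (TorusSite 3 L) 2 → ℂ, IsGround L (N + 1) ψ → IsGround L N ψ' →
        disc (poVec ψ') ψ (N + 1) * nsq (poVec ψ') * ((N : ℝ) + 1) ≤
          C_P * ((L : ℝ) ^ 2 * Real.sqrt L) * edgeDisc (poVec ψ') ψ (N + 1) * wdisc (poVec ψ') (N + 1))
    (hT : ∀ (L : ℕ) [NeZero L], 3 ≤ L → ∀ N : ℕ, 1 ≤ N → 2 * (N + 1) ≤ L ^ 3 →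
      ∀ ψ ψ' : TensorIndex (TorusSite 3 L) 2 → ℂ, IsGround L (N + 1) ψ → IsGround L N ψ' →
        ∀ M M₁ η : ℝ, 0 ≤ η →
          K1Ineq M L (N + 1) (poVec ψ') → K1IneqOne M₁ L (N + 1) (poVec ψ') →
          disc (poVec ψ') ψ (N + 1) ≤ η * wdisc (poVec ψ') (N + 1) →
          K1Ineq (max M M₁ * lossT C_T η L (N + 1)) L (N + 1) ψ ∧
          K1IneqOne (max M M₁ * lossT C_T η L (N + 1)) L (N + 1) ψ)
    (hL : 3 ≤ L) :
    ∀ n : ℕ, 2 ≤ n → 2 * n ≤ L ^ 3 →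
      K1Level (bnd C_A C_T (2 * C_P * C_B) L n) L n ∧ K1LevelOne (bnd C_A C_T (2 * C_P * C_B) L n) L n := by
  intro n hn
  induction n, hn using Nat.le_induction with
  | base =>
    intro _
    obtain ⟨hb2, hb1⟩ := h₁ L (by omega)
    rw [bnd_two]
    exact ⟨fun ψ hψ => K1Ineq_mono (by norm_num) (hb2 ψ hψ),
      fun ψ hψ => K1IneqOne_mono (by norm_num) (hb1 ψ hψ)⟩
  | succ N hN2 ih =>
    intro hNL
    have h2N : 2 * N ≤ L ^ 3 := le_trans (by omega) hNL
    obtain ⟨ihK, ihK1⟩ := ih h2N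
    rw [bnd_succ C_A C_T (2 * C_P * C_B) L N hN2]
    set B : ℝ := bnd C_A C_T (2 * C_P * C_B) L N with hBdef
    -- one admissible level-`N` datum to insert into
    obtain ⟨ψ', hψ'⟩ := exists_isGround (L := L) N (le_trans (by omega) hNL)
    have hK : K1Ineq B L N ψ' := ihK ψ' hψ'
    have hK1 : K1IneqOne B L N ψ' := ihK1 ψ' hψ'
    -- PO averaging: both functionals for `Φ = poVec ψ'` at level `N + 1`
    obtain ⟨hΦ, hΦ1⟩ := hA L hL N hN2 hNL B B ψ' hψ' hK hK1
    rw [max_self] at hΦ hΦ1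
    -- positivity facts
    have hn0 : 0 < nsq (poVec ψ') := nsq_poVec_pos hψ' (lt_of_lt_of_le (by omega) hNL)
    have hN1 : (0 : ℝ) < (N : ℝ) + 1 := by positivity
    have hN1' : (N : ℝ) + 1 ≠ 0 := hN1.ne'
    have hL0 : (L : ℝ) ≠ 0 := by exact_mod_cast (show L ≠ 0 by omega)
    have hη0 : 0 ≤ etaOf (2 * C_P * C_B) L (N + 1) := etaOf_nonneg (by positivity) L (N + 1)
    -- the step, datum by datum
    have step : ∀ ψ : TensorIndex (TorusSite 3 L) 2 → ℂ, IsGround L (N + 1) ψ →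
        K1Ineq (B * levelFactor C_A C_T (2 * C_P * C_B) L (N + 1)) L (N + 1) ψ ∧
        K1IneqOne (B * levelFactor C_A C_T (2 * C_P * C_B) L (N + 1)) L (N + 1) ψ := by
      intro ψ hψ
      have hid := h₃ L hL N (by omega) hNL ψ ψ' hψ hψ'
      have hbud := hB L hL N (by omega) hNL ψ' hψ'
      have hpoi := hP L hL N (by omega) hNL ψ ψ' hψ hψ'
      -- edge discrepancy ≤ 2 C_B/L³ ‖Φ‖² (identity + budget)
      have hedge : edgeDisc (poVec ψ') ψ (N + 1) ≤ 2 * (C_B / (L : ℝ) ^ 3 * nsq (poVec ψ')) := by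
        rw [hid]; linarith
      have hw0 : 0 ≤ wdisc (poVec ψ') (N + 1) := Finset.sum_nonneg fun T _ => sq_nonneg _
      have hfac0 : 0 ≤ C_P * ((L : ℝ) ^ 2 * Real.sqrt L) := by positivity
      have h1 : disc (poVec ψ') ψ (N + 1) * nsq (poVec ψ') * ((N : ℝ) + 1) ≤
          C_P * ((L : ℝ) ^ 2 * Real.sqrt L) * (2 * (C_B / (L : ℝ) ^ 3 * nsq (poVec ψ'))) *
            wdisc (poVec ψ') (N + 1) :=
        hpoi.trans (mul_le_mul_of_nonneg_right (mul_le_mul_of_nonneg_left hedge hfac0) hw0)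
      -- divide by `‖Φ‖²·(N+1) > 0`: `disc ≤ η · wdisc`
      have h2 : disc (poVec ψ') ψ (N + 1) * (nsq (poVec ψ') * ((N : ℝ) + 1)) ≤
          etaOf (2 * C_P * C_B) L (N + 1) * wdisc (poVec ψ') (N + 1) *
            (nsq (poVec ψ') * ((N : ℝ) + 1)) := by
        calc disc (poVec ψ') ψ (N + 1) * (nsq (poVec ψ') * ((N : ℝ) + 1))
            = disc (poVec ψ') ψ (N + 1) * nsq (poVec ψ') * ((N : ℝ) + 1) := by ring
          _ ≤ C_P * ((L : ℝ) ^ 2 * Real.sqrt L) * (2 * (C_B / (L : ℝ) ^ 3 * nsq (poVec ψ'))) *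
                wdisc (poVec ψ') (N + 1) := h1
          _ = etaOf (2 * C_P * C_B) L (N + 1) * wdisc (poVec ψ') (N + 1) *
                (nsq (poVec ψ') * ((N : ℝ) + 1)) := by
              rw [etaOf]
              push_cast
              field_simp
      have hdisc : disc (poVec ψ') ψ (N + 1) ≤
          etaOf (2 * C_P * C_B) L (N + 1) * wdisc (poVec ψ') (N + 1) :=
        le_of_mul_le_mul_right h2 (mul_pos hn0 hN1)
      -- transport
      have htr := hT L hL N (by omega) hNL ψ ψ' hψ hψ' (B * lossA C_A L (N + 1))
        (B * lossA C_A L (N + 1)) (etaOf (2 * C_P * C_B) L (N + 1)) hη0 hΦ hΦ1 hdisc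
      rw [max_self] at htr
      have heq : B * lossA C_A L (N + 1) * lossT C_T (etaOf (2 * C_P * C_B) L (N + 1)) L (N + 1) =
          B * levelFactor C_A C_T (2 * C_P * C_B) L (N + 1) := by
        unfold levelFactor; ring
      rw [heq] at htr
      exact htr
    exact ⟨fun ψ hψ => (step ψ hψ).1, fun ψ hψ => (step ψ hψ).2⟩

end Induction

/-! ## Composition: the crux from the six stubs -/

section Composition

/-- **The crux with an explicit constant from the six stubs** (pure glue: unpack the constants, run
`levels` for `L ≥ 3`, bound the product by `bnd_le`, and use the landed ceiling
`Negative.K1Ineq_two_mul_cube` for the side `L = 2`). [folklore] -/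
theorem insertionFieldDelocalisationAt_of_parts (h₁ : Sig.stub_twoBodyBase)
    (h₂ : Sig.stub_poAveraging) (h₃ : Sig.stub_coshBudgetIdentity) (h₄ : Sig.stub_poExcessBudget)
    (h₅ : Sig.stub_relocationPoincare) (h₆ : Sig.stub_discrepancyTransport) :
    ∃ M : ℝ, InsertionFieldDelocalisationAt M := by
  obtain ⟨C_A, hCA, hA⟩ := h₂
  obtain ⟨C_B, hCB, hB⟩ := h₄
  obtain ⟨C_P, hCP, hP⟩ := h₅
  obtain ⟨C_T, hCT, hT⟩ := h₆
  refine ⟨max (4 * Real.exp (5 / 2 * C_A + C_T * (6 * (2 * C_P * C_B) + 5 / 2))) 16, ?_⟩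
  intro L _ hL N hN hNL ψ hsec hne heig hnn
  by_cases hL3 : 3 ≤ L
  · have hlev := levels hCB hCP h₁ hA h₃ hB hP hT hL3 N hN hNL
    have hψ : IsGround L N ψ := ⟨hsec, hne, heig, hnn⟩
    have hK : K1Ineq (bnd C_A C_T (2 * C_P * C_B) L N) L N ψ := hlev.1 ψ hψ
    refine K1Ineq_mono ?_ hK
    exact (bnd_le hCA hCT (by positivity) L (by omega) N hN hNL).trans (le_max_left _ _)
  · have hL2 : L = 2 := by omega
    have hK := K1Ineq_two_mul_cube L N ψ fun σ => (hnn σ).1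
    have h16 : 2 * (L : ℝ) ^ 3 = 16 := by
      rw [show (L : ℝ) = 2 by exact_mod_cast hL2]; norm_num
    rw [h16] at hK
    exact K1Ineq_mono (le_max_right _ _) hK

/-- **The crux BY NAME from the six registered stubs** (`stub_twoBodyBase`, `stub_poAveraging`,
`stub_coshBudgetIdentity`, `stub_poExcessBudget`, `stub_relocationPoincare`,
`stub_discrepancyTransport`): no `sorry` of its own; its only open leaves are the stubs. [folklore] -/
theorem InsertionFieldDelocalisation_of :
    Summit.AtomisticToContinuum.BoseEinsteinCondensation.Theses.BECStronglyRayleigh.InsertionFieldDelocalisation :=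
  insertionFieldDelocalisation_iff.mpr
    (insertionFieldDelocalisationAt_of_parts stub_twoBodyBase stub_poAveraging stub_coshBudgetIdentity
      stub_poExcessBudget stub_relocationPoincare stub_discrepancyTransport)

end Composition


end Summit.AtomisticToContinuum.BoseEinsteinCondensation.Cruxes.InsertionFieldDelocalisation.CoshBudgetPenroseOnsager
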